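import Literature.NumberTheory.EllipticCurves.KellerYin2024.CharacterSelmerGroups
import Literature.NumberTheory.EllipticCurves.Agboola2007.RestrictedSelmerGroups
import HarnessLib

/-!
# Greenberg 1978, §4 (closing Remark): over the `ℤ_p`-extension of an imaginary quadratic field
# unramified outside ONE split prime `𝔭`, the `𝔭`-ramified Iwasawa module `X_∞ = Gal(M_∞/K_∞)` is a
# finitely generated TORSION `Λ`-module — ONE named fact, typed on the tree's character Selmer duals

Topic `NumberTheory/IwasawaTheory` (namespace = path, paper sub-namespace `Greenberg1978`). STATEMENT ONLY
(`def … : Prop`, D-0014; +1 declared debt), one abbreviation with a body; no `sorry`, no `instance`, no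
notation. Typed by the `bsd-2adic` cell (seat `bsd-2adic-t42` GEN 36) as print input (F2) of the GL(1) leaf
`TrivialCharSplitLineFiniteAt` of crux O2 (stmt-BirchSwinnertonDyer-24728, line `split_prime_line_finite_two`);
nothing about any elliptic curve or `L`-function is asserted here; typed ≠ proved.

## The printed statement

R. Greenberg, *On the structure of certain Galois groups*, Invent. Math. 47 (1978) 85–99 [Greenberg1978], §4,
closing Remark — as quoted VERBATIM by Oukhaba–Viguié, Forum Math. 28 (2016) = arXiv:1311.3565, p. 1 L15–27
(held text `paper:arxiv-1311.3565` p0001): "Let `k ⊂ ℂ` be an imaginary quadratic field … let `p` be a prime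
number which splits completely in `k`, that is `p𝒪_k = 𝔭𝔭̄` … we denote by `K_∞` (resp. `k_∞`) the unique
`ℤ_p`-extension of `K` (resp. `k`) unramified outside of `𝔭` … `X_∞ := Gal(M_∞/K_∞)`, where `M_∞` is the
maximal abelian `p`-extension of `K_∞` unramified outside of `𝔭`. Let us write `Γ := Gal(K_∞/K)`, then
`X_∞` is naturally a module over the Iwasawa algebra `Λ := ℤ_p[[Γ]]`. Moreover, **Greenberg has proved in
[12, Remark at the end of §4] that `X_∞` is a finitely generated torsion `Λ`-module and has no nontrivial
finite `Λ`-submodule**" ([12] = [Greenberg1978]); the same sentence in Choi–Kezuka–Li, arXiv:1711.01697 p. 3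
L21 (held `paper:arxiv-1711.01697` p0003): "it has long been known that `X(H_∞)` is a finitely generated
torsion module over `Λ(Γ)`". (The primary text [Greenberg1978] is held as `paper:doi-10-1007-bf01609481`
WITHOUT a text layer — acquisition request acq-10812 for a readable copy; the fact is typed from the two
quoting sources, and says so.)

## The dictionary (why this IS `X_∞`, up to the involution `ι`)

* `K_∞`: a `ℤ_p`-extension `κ : Γ_K →ₜ* ℤ_p` of the imaginary quadratic field `K`
  (`EllipticCurves.IsImaginaryQuadratic K`) that is UNRAMIFIED OUTSIDE the prime `v` above the split `p`
  (`Agboola2007`'s `ZpExtension.IsUnramifiedOutside κ v`: the chosen inertia group at every finite `w ≠ v`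
  lies in `ker κ`; by class field theory there is exactly one such line,
  `ZpExtension.existsUnique_isUnramifiedOutside_of_split`, so `K̄^{ker κ}` IS the printed `K_∞`); `p` split is
  spelled "two distinct primes `v ≠ v̄` of `K` above `p`" (`[K:ℚ] = 2`).
* `X_∞^∨`: by Pontryagin duality, `Hom_cont(X_∞, ℚ_p/ℤ_p)` is the group of continuous homomorphisms
  `Gal(K̄/K_∞) → ℚ_p/ℤ_p` unramified at every place of `K_∞` not above `v` — i.e. (trivial action:
  `H¹ = Hom`) the subgroup of `H¹(Gal(K̄/K_∞), ℚ_p/ℤ_p)` cut out by Greenberg–Vatsal's restricted-ramification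
  conditions: unramified (all conjugates) at every `w ∤ p`, unramified above `v̄`, nothing above `v` — which is
  EXACTLY the tree's `KellerYin2024.unrSelmer κ A v̄ ∅ = GreenbergVatsal2000.datumSelmerInfty κ A
  (Castella2018.AcSelmer.bdpData A p v̄) ∅` for the TRIVIAL character module
  `A = trivialCharacterModule K p := KellerYin2024.charModule ∅ 1 ≅ ℚ_p/ℤ_p` (group isomorphism
  `KellerYin2024.charModuleEquiv`, Galois action through `θ = 1`, i.e. trivial). (For `K` imaginary quadratic
  the primes above `p` are `v, v̄` only, and there is no archimedean condition.)
* `X_∞`: any Pontryagin-dual datum `X : GreenbergVatsal2000.DatumDualData κ γ A (bdpData A p v̄) ∅` (they EXIST: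
  `KellerYin2024.unrDualData`) is `Hom(X_∞^∨, ℚ/ℤ) ≅ X_∞` as a group, with `T ∈ Λ = ℤ_p⟦T⟧` acting as
  `conj_γ − 1`; on `X_∞` this is the `Λ`-structure `1 + T ↦ γ` composed with the involution `ι : γ ↦ γ⁻¹`
  (conjugation acts contravariantly on characters) — immaterial for finite generation, `Λ`-torsion, `μ` and
  finite generation over `ℤ_p` (the same reading as in `KellerYin2024/CharacterSelmerGroups.lean`).

## What is typed

* `trivialCharacterModule K p` — the abbreviation `KellerYin2024.charModule ∅ (1 : Γ_K →ₜ* GL₁(𝒪))`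
  (`𝒪 = padicCoeffIntegers ∅ ≅ ℤ_p`), the discrete `Γ_K`-module `ℚ_p/ℤ_p` with trivial action.
* `Greenberg1978.splitPrime_iwasawaModule_finite_torsion` — THE NAMED FACT: for every such
  `(K, p, v, v̄, κ, γ, X)`, `X` is finitely generated and torsion over `Λ = IwasawaAlgebra p`.
  NOT typed: "no nontrivial finite `Λ`-submodule" (not needed downstream).
-- TODO(general form): Greenberg 1978 treats `Gal(M/F_∞)` for the compositum `F_∞` of `ℤ_p`-extensions of
-- any number field (Λ-rank `r₂`, absence of finite submodules); only the imaginary-quadratic split-prime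
-- line (Λ-rank 0) quoted by [OukhabaViguie2016MuInvariant] is transcribed.

References: [Greenberg1978] §4 (closing Remark); [OukhabaViguie2016MuInvariant] p. 1 (arXiv:1311.3565 p0001
L15–27); [deShalit1987] II.4.17 (the unique `ℤ_p`-extension unramified outside `𝔭`); [Agboola2007] §1 p. 1;
[KellerYin2024] §1.2; [GreenbergVatsal2000] §2 p. 17.
-/

noncomputable section

open scoped Classical

open NumberField IsDedekindDomain Field
open Literature.NumberTheory.EllipticCurves Literature.NumberTheory.EllipticCurves.GreenbergSelmer
  Literature.NumberTheory.EllipticCurves.GreenbergVatsal2000 Literature.NumberTheory.GaloisRepresentations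

namespace Literature.NumberTheory.IwasawaTheory

/-- **`(ℚ_p/ℤ_p)(𝟙)`** — the discrete `Γ_K`-module `ℚ_p/ℤ_p` with TRIVIAL Galois action, as the Keller–Yin
carrier `(F/𝒪)(θ)` of the trivial character `θ = 1 : Γ_K →ₜ* GL₁(𝒪)`, `𝒪 = 𝒪_{ℚ_p(∅)} ≅ ℤ_p`
(`KellerYin2024.charModuleEquiv : charModule ∅ θ ≃+ ℚ_p/ℤ_p`). Its `H¹` over `K_∞` is
`Hom_cont(Gal(K̄/K_∞), ℚ_p/ℤ_p)`, the Pontryagin dual of `Gal(K_∞^{ab}/K_∞)`.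
[cite: KellerYin2024, §1.1 (arXiv:2402.12781v2 TeX L441–449)] -/
abbrev trivialCharacterModule (K : Type) [Field K] [NumberField K] (p : ℕ) [Fact p.Prime] : Type :=
  KellerYin2024.charModule (∅ : Set (PadicAlgCl p))
    (1 : FramedGaloisRep K (padicCoeffIntegers (∅ : Set (PadicAlgCl p))) 1)

namespace Greenberg1978

/-- **Greenberg 1978, §4, closing Remark** (as quoted by Oukhaba–Viguié 2016, p. 1: "Greenberg has proved in
[12, Remark at the end of §4] that `X_∞` is a finitely generated torsion `Λ`-module"). For an imaginary
quadratic field `K`, a prime `p = v v̄` SPLIT in `K` (`v ≠ v̄` above `p`), the `ℤ_p`-extension `κ` of `K`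
unramified outside `v` (`K_∞ = K̄^{ker κ}`) with a topological generator `γ`, and ANY Pontryagin-dual datum
`X` of `H¹_{nr outside v}(K_∞, ℚ_p/ℤ_p) = X_∞^∨` (`unrSelmer` of the trivial character module at `S₀ = ∅`,
strict prime `v̄`): the `Λ = ℤ_p⟦T⟧`-module `X ≅ X_∞ = Gal(M_∞/K_∞)` (`M_∞` the maximal abelian pro-`p`
extension of `K_∞` unramified outside `v`; `Λ`-structure up to the involution `γ ↦ γ⁻¹`) is FINITELY
GENERATED and TORSION. Named fact; all primes `p` (the source has no parity hypothesis). The "no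
nontrivial finite submodule" clause is not transcribed.
[cite: Greenberg1978, §4 (closing Remark; quoted in OukhabaViguie2016MuInvariant p. 1 L24–27 = arXiv:1311.3565 p0001)] -/
def splitPrime_iwasawaModule_finite_torsion : Prop :=
  ∀ (K : Type) [Field K] [NumberField K] (_hK : IsImaginaryQuadratic K) (p : ℕ) [Fact p.Prime]
    (v vbar : HeightOneSpectrum (𝓞 K)) (_hv : ((p : ℕ) : 𝓞 K) ∈ v.asIdeal)
    (_hvbar : ((p : ℕ) : 𝓞 K) ∈ vbar.asIdeal) (_hne : vbar ≠ v)
    (κ : ZpExtension K p) (_hκ : κ.IsUnramifiedOutside v)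
    (γ : absoluteGaloisGroup K) (_hγ : κ.IsTopGenerator γ)
    (X : DatumDualData κ γ (trivialCharacterModule K p)
      (Castella2018.AcSelmer.bdpData (trivialCharacterModule K p) p vbar) ∅),
    Module.Finite (IwasawaAlgebra p) X.X ∧ Module.IsTorsion (IwasawaAlgebra p) X.X

end Greenberg1978

end Literature.NumberTheory.IwasawaTheory

end
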